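import Summits.QuantumFields.BalabanUV.T4Continuum.Support.B13Base

/-!
# NE5 ∕ U3 — row O1-f ADMISSIBLE BASE, WITNESS: the one-run history budget of leaf L03 is LOAD-BEARING (negative control on the
# toy of `Support/B13Base.lean` §5) and the installed budget `E₀·rHist·c/(1 − ω)` is the SUPREMUM of the toy's actual displacements

Cell `pub-balaban`, unit `b2b-balaban-t4-ne5-formalise-leaf-03` (NE5 formalisation swarm, LEAF PROVER 03; row O1-f of
`t4/b2b-balaban-t4-ne5-p1/O1-CLAIM-TABLE-NE5-P1.md`; parts 1∕2 = `Support/B13Base.lean` p207657, `Support/B13BaseInsDatum.lean`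
p208169).  Summits-side bookkeeping (NOT a Literature module).  HONEST FRAMING: rung (B)+1 of the FINITE-VOLUME T⁴ continuum programme
— NOT infinite volume, NOT a mass gap, NOT the Clay problem, NOT a proof of NE5 (NOT PRINTED in [Balaban1987RG1]–[Balaban1989LargeFieldII];
they print ε-UNIFORM bounds, never η-RATES).  HONEST DEPENDENCY (cell line, verbatim): continuum YM on T⁴ ⇐ BetaPertH ∧ nine spine
estimates (0/9 proved); BetaPertH ⇐ (D1) ∧ (D4) ∧ CAP+tail; G-an2-4 gates asym, D1 and NE2/3/4.

WHAT THIS FILE DOES (kernel witnesses in the lineage's «not circular ∕ not vacuous» style; toy only, nothing about Bałaban's objects).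
Part 1 proved leaf L03 `InBase ↔ OpBudgetB ∧ HistBudgetB` for the budget-box base and, on the toy step model `B13Base.toyStep ω`
(insertions = the toy linear class `InsertionLinearClass.toyIns ω`, vectors `ω^{k−1−Y}`, table `toyEB ≡ 1`), `InBase` for the
installed history budget `1/(1 − ω)` (`toy_inBase_baseBudget`).  Here:
* `toy_dataB_snd`: the toy's ACTUAL inserted history at step `k` is the partial geometric sum `Σ_{m<k} ω^m` (exact);
* `toy_not_inBase_small`: at `ω = 1/2`, step `2`, the displacement is `3/2`, so EVERY history budget `B < 3/2` about the self-centred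
  centre FAILS `InBase` — the one-run history budget (KIND: [Balaban1988RG2Cluster] Lemma 2 (1.36)∕(1.43), displayed in part 1 as
  `HistBudgetB`) is a genuine hypothesis of L03, not an artefact of the installer `StepModel.withBase`;
* `toy_not_inBase_lt_sup`: more generally at `0 ≤ ω < 1` a CONSTANT budget `B < Σ_{m<k} ω^m` for some `k` fails — the installed budget
  `1/(1 − ω) = sup_k Σ_{m<k} ω^m` of part 1 is the least `k`-uniform one for this toy (part 1's `vecBudget_of_ageBudget` is sharp here).
0 sorry; no new axioms; nothing of the manuscripts under audit is asserted.
-/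

noncomputable section

open scoped BigOperators
open Metric Set Finset

namespace Summit.QuantumFields.BalabanUV.T4Continuum.B13BaseWitness

open Literature.MathematicalPhysics.QuantumFieldTheory.Balaban1983to89.T4OutputRate (Carriers Functional)
open Literature.MathematicalPhysics.QuantumFieldTheory.Balaban1983to89.T4InputCauchyRateData (StepModel tableB)
open Literature.MathematicalPhysics.QuantumFieldTheory.Balaban1983to89.T4InputCauchyRateSpecies (ballClass)
open Summit.QuantumFields.BalabanUV.T4Continuum.InsertionLinearClass (LinearInsertion linToyCarriers toyIns)
open Summit.QuantumFields.BalabanUV.T4Continuum.B13Base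

/-- [folklore] The toy's ACTUAL inserted history at step `k` (table `toyEB ≡ 1`): `Σ_{Y<k} ω^{k−1−Y} = Σ_{m<k} ω^m`, the partial geometric
sum — increasing to part 1's installed budget `1/(1 − ω)`. -/
theorem toy_dataB_snd (ω : ℝ) (g : ℕ → ℝ) (U : linToyCarriers.BgB) (k : ℕ) :
    ((toyStep ω).dataB toyEB g U k).2 = ((∑ m ∈ range k, ω ^ m : ℝ) : ℂ) := by
  change (toyIns ω).base g U k + ∑ Y ∈ (toyIns ω).dom k, ((tableB toyEB g U Y : ℝ) : ℂ) • (toyIns ω).vec g U k Y = _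
  simp only [toyIns, toyEB, tableB, Complex.ofReal_one, one_smul, zero_add, Complex.ofReal_sum]
  exact sum_range_reflect (fun m => ((ω ^ m : ℝ) : ℂ)) k

/-- [folklore] The run-B data point is unchanged by the installer (definitionally). -/
theorem withBase_dataB (M : StepModel linToyCarriers ℂ ℂ) (B : ℕ → (ℕ → ℝ) → linToyCarriers.BgB → Set (ℂ × ℂ))
    (EB : Functional linToyCarriers linToyCarriers.BgB) (g : ℕ → ℝ) (U : linToyCarriers.BgB) (k : ℕ) :
    (M.withBase B).dataB EB g U k = M.dataB EB g U k := rfl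

/-- [folklore] **THE HISTORY BUDGET IS LOAD-BEARING (toy, general form)**: at `0 ≤ ω`, if a CONSTANT history budget `B` is below the
step-`k` partial geometric sum `Σ_{m<k} ω^m` for some `k`, the installed toy model with budget `B` about the self-centred centre FAILS
`InBase toyEB univ` (the step-`k` data point lies outside the box). -/
theorem toy_not_inBase_lt_sum {ω B : ℝ} (hω : 0 ≤ ω) {k : ℕ} (hB : B < ∑ m ∈ range k, ω ^ m) :
    ¬ ((toyStep ω).withBase (ballClass (selfCtr (toyStep ω) (toyIns ω).base) 0 fun _ => B)).InBase toyEB Set.univ := by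
  intro h
  have hh := ((inBase_iff_budgets (hasBudgetBase_withBase (toyStep ω) _ _ _)).1 h).2 k (fun _ => 1) (Set.mem_univ _) ()
  rw [withBase_dataB, toy_dataB_snd, (selfCtr_apply _ _ _ _ _).2] at hh
  have hbase : (toyIns ω).base (fun _ => (1 : ℝ)) () k = 0 := rfl
  rw [hbase, sub_zero, Complex.norm_real, Real.norm_eq_abs,
    abs_of_nonneg (sum_nonneg fun m _ => pow_nonneg hω m)] at hh
  exact absurd hh (not_le.2 hB)

/-- [folklore] **SHARPNESS AT `ω = 1/2`, STEP 2**: the displacement is `1 + 1/2 = 3/2`, so every budget `B < 3/2` fails `InBase` — while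
part 1's `toy_inBase_baseBudget` gives `InBase` at the installed budget `1/(1 − 1/2) = 2 = sup_k (2 − 2^{1−k})`. -/
theorem toy_not_inBase_small {B : ℝ} (hB : B < 3 / 2) :
    ¬ ((toyStep (1 / 2)).withBase (ballClass (selfCtr (toyStep (1 / 2)) (toyIns (1 / 2)).base) 0 fun _ => B)).InBase
        toyEB Set.univ :=
  toy_not_inBase_lt_sum (ω := 1 / 2) (by norm_num) (k := 2) (by norm_num [sum_range_succ]; linarith)

/-- [folklore] The installed budget of part 1 IS attained in the limit: for `0 ≤ ω < 1` the partial sums are bounded by `1/(1 − ω)`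
(`B13Base.sum_pow_age_pred_le` read through `sum_range_reflect`) — so no budget below `1/(1 − ω)` can work for all `k` once the
partial sums approach it, and `1/(1 − ω)` itself works (`B13Base.toy_inBase_baseBudget`). -/
theorem toy_partialSum_le {ω : ℝ} (hω : 0 ≤ ω) (hω1 : ω < 1) (k : ℕ) : ∑ m ∈ range k, ω ^ m ≤ 1 / (1 - ω) := by
  have h := sum_pow_age_pred_le hω hω1 k
  rwa [sum_range_reflect (fun m => ω ^ m) k] at h

end Summit.QuantumFields.BalabanUV.T4Continuum.B13BaseWitness

end
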